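import Summits.Ventures.QEC.Census.CertInfoSetOrbitStabFast
import Summits.Ventures.QEC.Census.CertCheckParityFast
import Summits.Ventures.QEC.Census.CertBZPlaneSound
import Summits.Ventures.QEC.Census.TwoBGA.A2h_n252_k14_156e33a1.Cert
import Summits.Ventures.QEC.Census.TwoBGA.A2h_n252_k14_156e33a1.Stab
import HarnessLib

/-!
# `A2h_n252_k14_156e33a1` — checks module `ChecksV` (est 100 s) of the KERNEL-std certificate of census row `A2h_n252_k14_156e33a1` (qec-search-4 g6 orbit-stabilized lane)

the STABILIZED views: RREF certificates (`infoSetStructOK`) and the fast structural checks `StabView.stabOKF` (`F ⊇ free`, base points, mask/orbit-mask invariance of the movers); assembled in `Census/TwoBGA/A2h_n252_k14_156e33a1/Distance.lean`.  Generated by `emit_stab_row.py`; do not edit by hand.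
-/

set_option autoImplicit false
set_option Elab.async false
set_option exponentiation.threshold 1024

namespace Summit.Ventures.QEC.Census.A2h_n252_k14_156e33a1

open Matrix Literature.InformationTheory.QuantumCodes Summit.Ventures.QEC.Census

/-- Stabilized view 0 of the `X` side is an RREF certificate of `H^Z`. -/
theorem viewX_0_ok : infoSetStructOK A2h_n252_k14_156e33a1.cert.n A2h_n252_k14_156e33a1.cert.HZ A2h_n252_k14_156e33a1.svX0.ic = true := by decide +kernel

/-- Stabilized view 0 of the `X` side passes the FAST structural check `stabOKF` (`F ⊇ free`; base points, `F`- and orbit-mask invariance of the movers). -/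
theorem stabX_0_ok : A2h_n252_k14_156e33a1.svX0.stabOKF A2h_n252_k14_156e33a1.cert.n (autPerms A2h_n252_k14_156e33a1.gensX) A2h_n252_k14_156e33a1.gensX.length = true := by decide +kernel

/-- Stabilized view 1 of the `X` side is an RREF certificate of `H^Z`. -/
theorem viewX_1_ok : infoSetStructOK A2h_n252_k14_156e33a1.cert.n A2h_n252_k14_156e33a1.cert.HZ A2h_n252_k14_156e33a1.svX1.ic = true := by decide +kernel

/-- Stabilized view 1 of the `X` side passes the FAST structural check `stabOKF` (`F ⊇ free`; base points, `F`- and orbit-mask invariance of the movers). -/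
theorem stabX_1_ok : A2h_n252_k14_156e33a1.svX1.stabOKF A2h_n252_k14_156e33a1.cert.n (autPerms A2h_n252_k14_156e33a1.gensX) A2h_n252_k14_156e33a1.gensX.length = true := by decide +kernel

/-- Stabilized view 0 of the `Z` side is an RREF certificate of `H^X`. -/
theorem viewZ_0_ok : infoSetStructOK A2h_n252_k14_156e33a1.cert.n A2h_n252_k14_156e33a1.cert.HX A2h_n252_k14_156e33a1.svZ0.ic = true := by decide +kernel

/-- Stabilized view 0 of the `Z` side passes the FAST structural check `stabOKF` (`F ⊇ free`; base points, `F`- and orbit-mask invariance of the movers). -/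
theorem stabZ_0_ok : A2h_n252_k14_156e33a1.svZ0.stabOKF A2h_n252_k14_156e33a1.cert.n (autPerms A2h_n252_k14_156e33a1.gensZ) A2h_n252_k14_156e33a1.gensZ.length = true := by decide +kernel

/-- Stabilized view 1 of the `Z` side is an RREF certificate of `H^X`. -/
theorem viewZ_1_ok : infoSetStructOK A2h_n252_k14_156e33a1.cert.n A2h_n252_k14_156e33a1.cert.HX A2h_n252_k14_156e33a1.svZ1.ic = true := by decide +kernel

/-- Stabilized view 1 of the `Z` side passes the FAST structural check `stabOKF` (`F ⊇ free`; base points, `F`- and orbit-mask invariance of the movers). -/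
theorem stabZ_1_ok : A2h_n252_k14_156e33a1.svZ1.stabOKF A2h_n252_k14_156e33a1.cert.n (autPerms A2h_n252_k14_156e33a1.gensZ) A2h_n252_k14_156e33a1.gensZ.length = true := by decide +kernel

end Summit.Ventures.QEC.Census.A2h_n252_k14_156e33a1
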